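import Literature.NumberTheory.ConnesConsani2023.ZetaCyclesSemilocalFormProofs
import Mathlib.Analysis.SpecificLimits.Normed
import Mathlib.MeasureTheory.Group.Integral

/-!
# Hölder `L²`-modulus of continuity ⇒ finite log-Sobolev energy (Connes–Consani form domain; RH-FREE)

RH-FREE throughout (line 1 label): harmonic analysis of the log-Sobolev energy
`E(g) = ∫ |ĝ(½+is)|² (1 + log(1+s²)) ds` (`ConnesConsani2023.logSobolevEnergy`, the energy whose finiteness
defines the FORM DOMAIN of the semi-local Weil form `QW_λ`, Connes–Consani 2023 Lemma 2.2 eq. (2.16)); nothing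
here bears on the truth of RH.  Column DBR support file (cell rh-dbr, route candidate `ThetaFlowDecay`, binder K2a:
consumed by `Theorems/SuzukiThetaFlowFormDomain`).

MAIN RESULT `logSobolevEnergy_lt_top_of_holder` (a Besov embedding `B^{δ/2}_{2,∞} ∩ L¹ ⊂ H^{log}`): if
`g ∈ L¹ ∩ L²(ℝ)` has a HÖLDER `L²`-MODULUS OF CONTINUITY `∫‖g(x−h) − g(x)‖² dx ≤ C h^δ` for `0 < h ≤ 1` (some
`δ > 0`), then `E(g) < ∞`.  Hence every such `g` supported in `[−a,a]` lies in `ConnesConsani2023.formDomain a`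
(`mem_formDomain_of_holder`): step functions, indicators times Hölder functions, … (the tree's
`ZetaCyclesFiniteSections.logSobolevEnergy_chi_lt_top` is the special case of Yoshida's `χ_n`).

PROOF.  Shift law `(g(·−h) − g)^(½+is) = (e^{ish} − 1)·ĝ(½+is)` (`weilMellin_shift_sub`); Plancherel for
`L¹ ∩ L²` (tree `ConnesConsani2023.integral_norm_sq_weilMellin_half_line_of_memLp`) gives
`∫ (2 − 2cos(sh))|ĝ(½+is)|² ds = 2π ∫‖g(·−h) − g‖²` (`integral_cos_weight_norm_sq_weilMellin`); DYADIC pointwise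
bound (`ofReal_mul_logWeight_le`): on `|s| < 2`, `1 + log(1+s²) ≤ 1 + s² < 5`; on `2^{j+1} ≤ |s| < 2^{j+2}`,
`1 + log(1+s²) ≤ 4(j+2)` and `2 − 2cos(s h_j) ≥ 1` with `h_j = (π/3)·2^{−(j+1)}` (`|s| h_j ∈ [π/3, 2π/3]`,
`cos ≤ ½`); so `E(g) ≤ ∫5|ĝ|² + Σ_j 4(j+2)∫(2 − 2cos(s h_j))|ĝ|²` (`logSobolevEnergy_le_dyadic`, Tonelli) and the
right side is `≤ 5·2π‖g‖₂² + Σ_j 4(j+2)·2πC·(π/3)^δ 2^{−(j+1)δ} < ∞`.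

References: A. Connes, C. Consani, *Spectral triples and ζ-cycles*, Enseign. Math. 69 (2023) §2.1, Lemma 2.2
(2.16); E. C. Titchmarsh, *Fourier Integrals*, Thm. 48 (Plancherel).
-/

noncomputable section

-- D-0017: `Summit.<S>.<S>.…` is the designed namespace of a single-problem summit.
set_option linter.dupNamespace false

open Complex MeasureTheory Set Filter Topology
open scoped Real ENNReal

namespace Summit.RiemannHypothesis.RiemannHypothesis.Theorems.LogSobolevHolder

open Literature.NumberTheory.LFunctions
open Literature.NumberTheory.ConnesConsani2023

/-! ## §1 Hölder `L²`-modulus ⇒ finite log-Sobolev energy (general, RH-FREE) -/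

section General

variable {g : ℝ → ℂ}

/-- RH-FREE.  Shift law of the additive Mellin transform: `(g(· − h))^(w) = e^{(w−½)h} ĝ(w)`. -/
theorem weilMellin_comp_sub_right (g : ℝ → ℂ) (h : ℝ) (w : ℂ) :
    weilMellin (fun x ↦ g (x - h)) w = cexp ((w - 1 / 2) * h) * weilMellin g w := by
  unfold weilMellin
  rw [← integral_const_mul]
  have e : (fun x : ℝ ↦ cexp ((w - 1 / 2) * h) * (g x * cexp ((w - 1 / 2) * x))) =
      fun x : ℝ ↦ (fun y : ℝ ↦ g (y - h) * cexp ((w - 1 / 2) * y)) (x + h) := by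
    funext x
    simp only [add_sub_cancel_right]
    rw [mul_left_comm, ← Complex.exp_add]
    congr 2
    push_cast
    ring
  rw [e, integral_add_right_eq_self (μ := volume) (fun y : ℝ ↦ g (y - h) * cexp ((w - 1 / 2) * y)) h]

/-- RH-FREE.  The integrand of `ĝ(½ + is)` is integrable for `g ∈ L¹` (unimodular kernel). -/
theorem integrable_mul_cexp_half (hg : Integrable g) (s : ℝ) :
    Integrable fun x : ℝ ↦ g x * cexp ((1 / 2 + s * I - 1 / 2) * x) := by
  refine hg.mul_bdd (c := 1) (by fun_prop : Continuous fun x : ℝ ↦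
    cexp ((1 / 2 + s * I - 1 / 2) * x)).aestronglyMeasurable (Eventually.of_forall fun x ↦ ?_)
  rw [Complex.norm_exp]
  have : ((1 / 2 + (s : ℂ) * I - 1 / 2) * x).re = 0 := by simp [Complex.mul_re]
  rw [this, Real.exp_zero]

/-- RH-FREE.  `‖e^{iu} − 1‖² = 2 − 2cos u`. -/
theorem norm_cexp_mul_I_sub_one_sq (u : ℝ) : ‖cexp (u * I) - 1‖ ^ 2 = 2 - 2 * Real.cos u := by
  rw [Complex.sq_norm, Complex.normSq_apply, Complex.sub_re, Complex.sub_im, Complex.one_re,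
    Complex.one_im, Complex.exp_ofReal_mul_I_re, Complex.exp_ofReal_mul_I_im]
  linear_combination Real.sin_sq_add_cos_sq u

/-- RH-FREE.  **Shift law for differences**: `(g(·−h) − g)^(½+is) = (e^{ish} − 1)·ĝ(½+is)`, `g ∈ L¹`. -/
theorem weilMellin_shift_sub (hg : Integrable g) (h s : ℝ) :
    weilMellin (fun x ↦ g (x - h) - g x) (1 / 2 + s * I) =
      (cexp ((s * h : ℝ) * I) - 1) * weilMellin g (1 / 2 + s * I) := by
  have h1 : Integrable (fun x : ℝ ↦ g (x - h)) := hg.comp_sub_right h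
  have hsplit : weilMellin (fun x ↦ g (x - h) - g x) (1 / 2 + s * I) =
      weilMellin (fun x ↦ g (x - h)) (1 / 2 + s * I) - weilMellin g (1 / 2 + s * I) := by
    unfold weilMellin
    rw [← integral_sub (integrable_mul_cexp_half h1 s) (integrable_mul_cexp_half hg s)]
    congr 1 with x
    ring
  rw [hsplit, weilMellin_comp_sub_right]
  have e : cexp ((1 / 2 + (s : ℂ) * I - 1 / 2) * (h : ℂ)) = cexp (((s * h : ℝ) : ℂ) * I) := by
    congr 1
    push_cast
    ring
  rw [e]
  ring

/-- RH-FREE.  `‖(g(·−h) − g)^(½+is)‖² = (2 − 2cos(sh))·‖ĝ(½+is)‖²`. -/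
theorem norm_sq_weilMellin_shift_sub (hg : Integrable g) (h s : ℝ) :
    ‖weilMellin (fun x ↦ g (x - h) - g x) (1 / 2 + s * I)‖ ^ 2 =
      (2 - 2 * Real.cos (s * h)) * ‖weilMellin g (1 / 2 + s * I)‖ ^ 2 := by
  rw [weilMellin_shift_sub hg, norm_mul, mul_pow, norm_cexp_mul_I_sub_one_sq]

/-- RH-FREE.  **Plancherel for the shifted difference**:
`∫ (2 − 2cos(sh)) |ĝ(½+is)|² ds = 2π ∫ ‖g(x−h) − g(x)‖² dx` for `g ∈ L¹ ∩ L²`. -/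
theorem integral_cos_weight_norm_sq_weilMellin (hg : Integrable g) (hg2 : MemLp g 2 volume) (h : ℝ) :
    ∫ s : ℝ, (2 - 2 * Real.cos (s * h)) * ‖weilMellin g (1 / 2 + s * I)‖ ^ 2 =
      2 * π * ∫ x, ‖g (x - h) - g x‖ ^ 2 := by
  have h1 : Integrable (fun x : ℝ ↦ g (x - h) - g x) := (hg.comp_sub_right h).sub hg
  have h2 : MemLp (fun x : ℝ ↦ g (x - h) - g x) 2 volume :=
    (hg2.comp_measurePreserving (measurePreserving_sub_right volume h)).sub hg2
  rw [← integral_norm_sq_weilMellin_half_line_of_memLp h1 h2]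
  congr 1 with s
  rw [norm_sq_weilMellin_shift_sub hg]

/-- RH-FREE.  The shifted difference has an integrable Plancherel density, equal (as a `lintegral`) to
`2π ∫‖g(·−h) − g‖²`. -/
theorem lintegral_cos_weight_norm_sq_weilMellin (hg : Integrable g) (hg2 : MemLp g 2 volume) (h : ℝ) :
    ∫⁻ s : ℝ, ENNReal.ofReal ((2 - 2 * Real.cos (s * h)) * ‖weilMellin g (1 / 2 + s * I)‖ ^ 2) =
      ENNReal.ofReal (2 * π * ∫ x, ‖g (x - h) - g x‖ ^ 2) := by
  have h1 : Integrable (fun x : ℝ ↦ g (x - h) - g x) := (hg.comp_sub_right h).sub hg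
  have h2 : MemLp (fun x : ℝ ↦ g (x - h) - g x) 2 volume :=
    (hg2.comp_measurePreserving (measurePreserving_sub_right volume h)).sub hg2
  have hint := integrable_norm_sq_weilMellin_half_line_of_memLp h1 h2
  have hint' : Integrable fun s : ℝ ↦ (2 - 2 * Real.cos (s * h)) * ‖weilMellin g (1 / 2 + s * I)‖ ^ 2 :=
    hint.congr (Eventually.of_forall fun s ↦ (norm_sq_weilMellin_shift_sub hg h s))
  have hnn : 0 ≤ᵐ[volume] fun s : ℝ ↦ (2 - 2 * Real.cos (s * h)) * ‖weilMellin g (1 / 2 + s * I)‖ ^ 2 :=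
    Eventually.of_forall fun s ↦ by
      have hc : Real.cos (s * h) ≤ 1 := Real.cos_le_one _
      have : 0 ≤ 2 - 2 * Real.cos (s * h) := by linarith
      positivity
  rw [← integral_cos_weight_norm_sq_weilMellin hg hg2 h, ofReal_integral_eq_lintegral_ofReal hint' hnn]

/-- RH-FREE.  `0 < h_j ≤ 1`. -/
theorem dyadicScale_pos (j : ℕ) : 0 < π / 3 * (1 / 2 : ℝ) ^ (j + 1) := by positivity

/-- RH-FREE.  `h_j ≤ 1`. -/
theorem dyadicScale_le_one (j : ℕ) : π / 3 * (1 / 2 : ℝ) ^ (j + 1) ≤ 1 := by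
  have hp : π / 3 ≤ 2 := by linarith [Real.pi_lt_d2]
  have hq : (1 / 2 : ℝ) ^ (j + 1) ≤ 1 / 2 := by
    calc (1 / 2 : ℝ) ^ (j + 1) ≤ (1 / 2) ^ 1 := pow_le_pow_of_le_one (by norm_num) (by norm_num) (by omega)
      _ = 1 / 2 := pow_one _
  nlinarith [pow_nonneg (by norm_num : (0 : ℝ) ≤ 1 / 2) (j + 1), Real.pi_pos]

/-- RH-FREE.  On the annulus `2^{j+1} ≤ |s| < 2^{j+2}`: `2 − 2cos(s h_j) ≥ 1` (`|s| h_j ∈ [π/3, 2π/3]`). -/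
theorem one_le_cos_weight {s : ℝ} {j : ℕ} (h1 : (2 : ℝ) ^ (j + 1) ≤ |s|) (h2 : |s| < (2 : ℝ) ^ (j + 2)) :
    1 ≤ 2 - 2 * Real.cos (s * (π / 3 * (1 / 2 : ℝ) ^ (j + 1))) := by
  have hh := dyadicScale_pos j
  have hprod : |s| * (π / 3 * (1 / 2 : ℝ) ^ (j + 1)) = π / 3 * (|s| / 2 ^ (j + 1)) := by
    rw [one_div_pow]
    field_simp
  have hlow : π / 3 ≤ |s| * (π / 3 * (1 / 2 : ℝ) ^ (j + 1)) := by
    rw [hprod]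
    have : 1 ≤ |s| / 2 ^ (j + 1) := by rwa [le_div_iff₀ (by positivity), one_mul]
    nlinarith [Real.pi_pos]
  have hup : |s| * (π / 3 * (1 / 2 : ℝ) ^ (j + 1)) ≤ π := by
    rw [hprod]
    have : |s| / 2 ^ (j + 1) ≤ 2 := by
      rw [div_le_iff₀ (by positivity)]
      have : (2 : ℝ) ^ (j + 2) = 2 * 2 ^ (j + 1) := by ring
      linarith
    nlinarith [Real.pi_pos]
  have hcos : Real.cos (|s| * (π / 3 * (1 / 2 : ℝ) ^ (j + 1))) ≤ 1 / 2 := by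
    have h := Real.cos_le_cos_of_nonneg_of_le_pi (by positivity) hup hlow
    rwa [Real.cos_pi_div_three] at h
  have heven : Real.cos (s * (π / 3 * (1 / 2 : ℝ) ^ (j + 1))) = Real.cos (|s| * (π / 3 * (1 / 2 : ℝ) ^ (j + 1))) := by
    rw [← Real.cos_abs (s * (π / 3 * (1 / 2 : ℝ) ^ (j + 1))), abs_mul, abs_of_pos hh]
  rw [heven]
  linarith

/-- RH-FREE.  On the annulus `2^{j+1} ≤ |s| < 2^{j+2}`: `1 + log(1+s²) ≤ 4(j+2)`. -/
theorem logWeight_le_of_lt_pow {s : ℝ} {j : ℕ} (h2 : |s| < (2 : ℝ) ^ (j + 2)) :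
    1 + Real.log (1 + s ^ 2) ≤ 4 * ((j : ℝ) + 2) := by
  have hs2 : s ^ 2 < ((2 : ℝ) ^ (j + 2)) ^ 2 := by
    rw [← sq_abs s]
    exact pow_lt_pow_left₀ h2 (abs_nonneg s) two_ne_zero
  have hpow : ((2 : ℝ) ^ (j + 2)) ^ 2 = 2 ^ (2 * (j + 2)) := by rw [← pow_mul, mul_comm]
  have h1 : 1 + s ^ 2 ≤ (2 : ℝ) ^ (2 * (j + 2) + 1) := by
    have hone : (1 : ℝ) ≤ 2 ^ (2 * (j + 2)) := one_le_pow₀ (by norm_num)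
    have hps : (2 : ℝ) ^ (2 * (j + 2) + 1) = 2 ^ (2 * (j + 2)) * 2 := pow_succ _ _
    rw [hps]
    rw [hpow] at hs2
    linarith
  have hlog : Real.log (1 + s ^ 2) ≤ (2 * (j + 2) + 1 : ℕ) * Real.log 2 := by
    rw [← Real.log_pow]
    exact Real.log_le_log (by positivity) h1
  have hl2 : Real.log 2 < 0.6931471808 := Real.log_two_lt_d9
  have hcast : ((2 * (j + 2) + 1 : ℕ) : ℝ) = 2 * (j : ℝ) + 5 := by push_cast; ring
  rw [hcast] at hlog
  have hj : (0 : ℝ) ≤ j := Nat.cast_nonneg j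
  nlinarith [Real.log_pos (by norm_num : (1 : ℝ) < 2)]

/-- RH-FREE.  **The dyadic pointwise bound**: for `F ≥ 0` and every real `s`,
`F·(1 + log(1+s²)) ≤ 5F + Σ_j 4(j+2)·(2 − 2cos(s h_j))·F` (in `ℝ≥0∞`). -/
theorem ofReal_mul_logWeight_le (F : ℝ) (hF : 0 ≤ F) (s : ℝ) :
    ENNReal.ofReal (F * (1 + Real.log (1 + s ^ 2))) ≤
      ENNReal.ofReal (5 * F) +
        ∑' j : ℕ, ENNReal.ofReal (4 * ((j : ℝ) + 2) * ((2 - 2 * Real.cos (s * (π / 3 * (1 / 2 : ℝ) ^ (j + 1)))) * F)) := by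
  rcases lt_or_ge |s| 2 with hs | hs
  · -- inner region: `1 + log(1+s²) ≤ 1 + s² < 5`
    have hs2 : s ^ 2 < 4 := by
      rw [← sq_abs s]; nlinarith [abs_nonneg s]
    have hlog : Real.log (1 + s ^ 2) ≤ s ^ 2 := by
      have := Real.log_le_sub_one_of_pos (by positivity : (0 : ℝ) < 1 + s ^ 2)
      linarith
    refine le_add_right ?_
    exact ENNReal.ofReal_le_ofReal (by nlinarith)
  · -- dyadic annulus
    obtain ⟨n, hn1, hn2⟩ := exists_nat_pow_near (x := |s|) (y := (2 : ℝ)) (by linarith) one_lt_two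
    have hnpos : n ≠ 0 := by
      rintro rfl
      rw [zero_add, pow_one] at hn2
      linarith
    obtain ⟨j, rfl⟩ := Nat.exists_eq_succ_of_ne_zero hnpos
    rw [Nat.succ_eq_add_one] at hn1 hn2
    have hw := logWeight_le_of_lt_pow (s := s) (j := j) (by simpa [add_assoc] using hn2)
    have hc := one_le_cos_weight hn1 (by simpa [add_assoc] using hn2)
    refine le_add_left ?_
    refine le_trans ?_ (ENNReal.le_tsum j)
    refine ENNReal.ofReal_le_ofReal ?_
    have hlogw : 0 ≤ 1 + Real.log (1 + s ^ 2) := by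
      have := Real.log_nonneg (by nlinarith [sq_nonneg s] : (1 : ℝ) ≤ 1 + s ^ 2)
      linarith
    calc F * (1 + Real.log (1 + s ^ 2)) ≤ F * (4 * ((j : ℝ) + 2)) := by gcongr
      _ = 4 * ((j : ℝ) + 2) * (1 * F) := by ring
      _ ≤ 4 * ((j : ℝ) + 2) * ((2 - 2 * Real.cos (s * (π / 3 * (1 / 2 : ℝ) ^ (j + 1)))) * F) := by gcongr

/-- RH-FREE.  **The dyadic energy bound**: for `g ∈ L¹`,
`E(g) ≤ ∫ 5|ĝ|² + Σ_j 4(j+2) ∫ (2 − 2cos(s h_j))|ĝ(½+is)|² ds`. -/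
theorem logSobolevEnergy_le_dyadic (hg : Integrable g) :
    logSobolevEnergy g ≤
      (∫⁻ s : ℝ, ENNReal.ofReal (5 * ‖weilMellin g (1 / 2 + s * I)‖ ^ 2)) +
        ∑' j : ℕ, ∫⁻ s : ℝ, ENNReal.ofReal
          (4 * ((j : ℝ) + 2) * ((2 - 2 * Real.cos (s * (π / 3 * (1 / 2 : ℝ) ^ (j + 1)))) * ‖weilMellin g (1 / 2 + s * I)‖ ^ 2)) := by
  have hcont := continuous_weilMellin_half_line_of_integrable hg
  have hF : Measurable fun s : ℝ ↦ ‖weilMellin g (1 / 2 + s * I)‖ ^ 2 :=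
    (hcont.norm.pow 2).measurable
  have hm5 : Measurable fun s : ℝ ↦ ENNReal.ofReal (5 * ‖weilMellin g (1 / 2 + s * I)‖ ^ 2) :=
    (measurable_const.mul hF).ennreal_ofReal
  have hmj : ∀ j : ℕ, Measurable fun s : ℝ ↦ ENNReal.ofReal
      (4 * ((j : ℝ) + 2) * ((2 - 2 * Real.cos (s * (π / 3 * (1 / 2 : ℝ) ^ (j + 1)))) * ‖weilMellin g (1 / 2 + s * I)‖ ^ 2)) := by
    intro j
    have hc : Measurable fun s : ℝ ↦ 2 - 2 * Real.cos (s * (π / 3 * (1 / 2 : ℝ) ^ (j + 1))) :=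
      measurable_const.sub (measurable_const.mul (Real.measurable_cos.comp (measurable_id.mul_const _)))
    exact (measurable_const.mul (hc.mul hF)).ennreal_ofReal
  unfold logSobolevEnergy
  refine (lintegral_mono fun s ↦ ofReal_mul_logWeight_le _ (sq_nonneg _) s).trans ?_
  rw [lintegral_add_left hm5, lintegral_tsum fun j ↦ (hmj j).aemeasurable]

/-- RH-FREE.  **HÖLDER `L²`-MODULUS ⇒ FINITE LOG-SOBOLEV ENERGY** (a Besov embedding `B^{δ/2}_{2,∞} ⊂ H^{log}`):
if `g ∈ L¹ ∩ L²(ℝ)` and `∫‖g(x−h) − g(x)‖² dx ≤ C h^δ` for `0 < h ≤ 1` (some `δ > 0`), then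
`∫ |ĝ(½+is)|² (1 + log(1+s²)) ds < ∞`. -/
theorem logSobolevEnergy_lt_top_of_holder (hg : Integrable g) (hg2 : MemLp g 2 volume) {C δ : ℝ}
    (hδ : 0 < δ) (hmod : ∀ h : ℝ, 0 < h → h ≤ 1 → ∫ x, ‖g (x - h) - g x‖ ^ 2 ≤ C * h ^ δ) :
    logSobolevEnergy g < ∞ := by
  have hP := integrable_norm_sq_weilMellin_half_line_of_memLp hg hg2
  -- the summable majorant
  set r : ℝ := (1 / 2 : ℝ) ^ δ with hr
  have hr0 : 0 ≤ r := Real.rpow_nonneg (by norm_num) δ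
  have hr1 : r < 1 := Real.rpow_lt_one (by norm_num) (by norm_num) hδ
  set a : ℕ → ℝ := fun j ↦ 4 * ((j : ℝ) + 2) * (2 * π * (C * ((π / 3) ^ δ * r ^ (j + 1)))) with ha
  have hC : 0 ≤ C := by
    have h := hmod 1 one_pos le_rfl
    rw [Real.one_rpow, mul_one] at h
    exact le_trans (integral_nonneg fun x ↦ by positivity) h
  have ha0 : ∀ j, 0 ≤ a j := fun j ↦ by
    simp only [ha]
    have : 0 ≤ (π / 3) ^ δ := Real.rpow_nonneg (by positivity) δ
    positivity
  have hsum : Summable a := by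
    have h1 : Summable fun j : ℕ ↦ ((j : ℝ) ^ 1) * r ^ j :=
      summable_pow_mul_geometric_of_norm_lt_one 1 (by rwa [Real.norm_eq_abs, abs_of_nonneg hr0])
    have h2 : Summable fun j : ℕ ↦ r ^ j := summable_geometric_of_lt_one hr0 hr1
    have h3 : Summable fun j : ℕ ↦ ((j : ℝ) + 2) * r ^ j := by
      have := h1.add (h2.mul_left 2)
      refine this.congr fun j ↦ ?_
      simp only [pow_one]; ring
    have h4 := h3.mul_left (4 * (2 * π * (C * ((π / 3) ^ δ * r))))
    refine h4.congr fun j ↦ ?_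
    simp only [ha, pow_succ]
    ring
  -- scale identity `h_j^δ = (π/3)^δ r^{j+1}`
  have hscale : ∀ j : ℕ, (π / 3 * (1 / 2 : ℝ) ^ (j + 1)) ^ δ = (π / 3) ^ δ * r ^ (j + 1) := by
    intro j
    rw [Real.mul_rpow (by positivity) (by positivity), hr]
    congr 1
    rw [← Real.rpow_natCast ((1 / 2 : ℝ) ^ δ) (j + 1), ← Real.rpow_mul (by norm_num),
      mul_comm, Real.rpow_mul (by norm_num), Real.rpow_natCast]
  -- each dyadic term is at most `ofReal (a j)`
  have hterm : ∀ j : ℕ, (∫⁻ s : ℝ, ENNReal.ofReal (4 * ((j : ℝ) + 2) *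
      ((2 - 2 * Real.cos (s * (π / 3 * (1 / 2 : ℝ) ^ (j + 1)))) * ‖weilMellin g (1 / 2 + s * I)‖ ^ 2))) ≤
      ENNReal.ofReal (a j) := by
    intro j
    have hc : ∀ s : ℝ, 0 ≤ (2 - 2 * Real.cos (s * (π / 3 * (1 / 2 : ℝ) ^ (j + 1)))) *
        ‖weilMellin g (1 / 2 + s * I)‖ ^ 2 := fun s ↦ by
      have : Real.cos (s * (π / 3 * (1 / 2 : ℝ) ^ (j + 1))) ≤ 1 := Real.cos_le_one _
      have : 0 ≤ 2 - 2 * Real.cos (s * (π / 3 * (1 / 2 : ℝ) ^ (j + 1))) := by linarith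
      positivity
    have e : ∀ s : ℝ, ENNReal.ofReal (4 * ((j : ℝ) + 2) *
        ((2 - 2 * Real.cos (s * (π / 3 * (1 / 2 : ℝ) ^ (j + 1)))) * ‖weilMellin g (1 / 2 + s * I)‖ ^ 2)) =
        ENNReal.ofReal (4 * ((j : ℝ) + 2)) * ENNReal.ofReal
          ((2 - 2 * Real.cos (s * (π / 3 * (1 / 2 : ℝ) ^ (j + 1)))) * ‖weilMellin g (1 / 2 + s * I)‖ ^ 2) :=
      fun s ↦ ENNReal.ofReal_mul (by positivity)
    simp_rw [e]
    rw [lintegral_const_mul' _ _ ENNReal.ofReal_ne_top,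
      lintegral_cos_weight_norm_sq_weilMellin hg hg2, ← ENNReal.ofReal_mul (by positivity)]
    refine ENNReal.ofReal_le_ofReal ?_
    simp only [ha]
    have hm := hmod ((π / 3 * (1 / 2 : ℝ) ^ (j + 1))) (dyadicScale_pos j) (dyadicScale_le_one j)
    rw [hscale j] at hm
    have hj : (0 : ℝ) ≤ 4 * ((j : ℝ) + 2) := by positivity
    exact mul_le_mul_of_nonneg_left (mul_le_mul_of_nonneg_left hm (by positivity)) hj
  -- assemble
  refine lt_of_le_of_lt (logSobolevEnergy_le_dyadic hg) ?_
  refine ENNReal.add_lt_top.2 ⟨?_, ?_⟩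
  · exact ((hP.const_mul 5).lintegral_lt_top)
  · refine lt_of_le_of_lt (ENNReal.tsum_le_tsum hterm) ?_
    rw [← ENNReal.ofReal_tsum_of_nonneg ha0 hsum]
    exact ENNReal.ofReal_lt_top


/-- RH-FREE.  **Form-domain membership from a Hölder `L²`-modulus**: `g ∈ L¹ ∩ L²`, `supp g ⊆ [−a,a]`,
`∫‖g(·−h) − g‖² ≤ C h^δ` (`0 < h ≤ 1`) ⇒ `g ∈ ConnesConsani2023.formDomain a`. -/
theorem mem_formDomain_of_holder {a : ℝ} (hg : Integrable g) (hg2 : MemLp g 2 volume)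
    (hsupp : Function.support g ⊆ Icc (-a) a) {C δ : ℝ} (hδ : 0 < δ)
    (hmod : ∀ h : ℝ, 0 < h → h ≤ 1 → ∫ x, ‖g (x - h) - g x‖ ^ 2 ≤ C * h ^ δ) :
    g ∈ formDomain a :=
  ⟨hg2, hsupp, logSobolevEnergy_lt_top_of_holder hg hg2 hδ hmod⟩

end General

end Summit.RiemannHypothesis.RiemannHypothesis.Theorems.LogSobolevHolder

end
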